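import Summits.ResolutionOfSingularities.ResolutionOfSingularities.Theorems.BirthCountCutCells
import HarnessLib

/-! # CofactorCutKernels — decomp-res-lens-4 g39 «CofactorCut», FILE A (§124 Law D «no double birth»; §125 the letters (KI∞)/(KFB)/
«isolated factor», the minimal-weight currency `MinimalAt` (= g16's `hlow`, cited) and the descent law).  See the node header in
HOME/decomp-res-lens-4/g39/CofactorCut.lean for the thesis, the honest tags and the placement. -/

set_option linter.dupNamespace false
set_option linter.unusedSectionVars false

noncomputable section

open CategoryTheory AlgebraicGeometry IsLocalRing TopologicalSpace
open Literature.AlgebraicGeometry.Resolution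
open Summit.ResolutionOfSingularities.ResolutionOfSingularities.Theorems
open WeakOrderReduction ForcedTowerClasses DivergentTowerClasses MonomialTowerClasses
open HugDimensionClasses HugDimensionKernels SurfaceShadowClasses SurfaceShadowKernels
open NearPointCut (SingularClass)
open Scheme.IdealSheafData (vanishingIdeal)

universe u

namespace Summit.ResolutionOfSingularities.ResolutionOfSingularities.Theorems.HugValuationCut

/-! ## ══ FILE A `Theorems/CofactorCutKernels.lean` (§124–§125; cone-free; imports the LANDED `BirthCountCutCells`) ══ -/

section DisjointBranches

/-! ## §124 (g39 · NEW · KERNEL LAW) LAW D — THE TWO FACTORS OF A STALK FACTORIZATION HAVE DISJOINT NEAR-BRANCHES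

Class-general (every `p`, field, class, weight, dimension; no occultness, no principality): along a common proper generization
`η ⤳ x_i` with `ord_η H ≥ a` and `ord_η K ≥ b` the stalk identity `𝓘_{i,η} = H_η · K_η` (`𝓘_η = 𝓘_{x_i}·𝒪_η`, Literature
`stalkIdeal_map_stalkSpecializes`) gives `ord_η 𝓘_i ≥ a + b = n`, against the tower axiom `isolated`
(`tower_not_le_idealOrder_of_specializes`).  Consequences: STRONG PINNING (`ord_η K < b` at every near-branch of `H`) and NO DOUBLE
BIRTH (an exceptional near-branch born for `h` is never a near-branch of the cofactor chain) — the «double birth» sub-kind (DB∞) of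
NEXT-g39 §0 is EMPTY BY LETTERS for every tower. -/

variable {k : Type} [Field k]

/-- **LAW D (DISJOINT NEAR-BRANCHES; kernel, class-general)**: in a forced tower the two factors of a stalk factorization
`𝓘_{x_i} = H·K` of weights `(a, b)` have NO common near-branch at `x_i`.
(Sources: Matsumura1987, Thm. 14.2; StacksProject, Tag 01J7; Hironaka1964, Ch. III §3.) -/
theorem brSet_disjoint_of_factorAt (T : ForcedTower) (g : T.St 0 ⟶ Spec (.of k)) (hB : IsBase (T.St 0) g) {n : ℕ}
    (hD : IsDatum n (T.D 0)) {i a b : ℕ} {H K : (T.St i).IdealSheafData} (hF : FactorAt T i a b H K) :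
    Disjoint (brSet T i a H) (brSet T i b K) := by
  rw [Set.disjoint_left]
  rintro η ⟨hη, hne, hH⟩ ⟨-, -, hK⟩
  have hab : a + b = n := hF.add_eq T g hB hD
  apply tower_not_le_idealOrder_of_specializes T hD i η hη hne
  rw [le_idealOrder_iff, ← stalkIdeal_map_stalkSpecializes (T.D i).ideal hη, hF.1, Ideal.map_mul,
    stalkIdeal_map_stalkSpecializes, stalkIdeal_map_stalkSpecializes, ← hab, pow_add]
  exact Ideal.mul_mono ((le_idealOrder_iff H η a).mp hH) ((le_idealOrder_iff K η b).mp hK)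

/-- **STRONG PINNING**: at every near-branch `η` of the factor `H` (weight `a`) the cofactor has order `< b`. [folklore] -/
theorem idealOrder_lt_of_mem_brSet (T : ForcedTower) (g : T.St 0 ⟶ Spec (.of k)) (hB : IsBase (T.St 0) g) {n : ℕ}
    (hD : IsDatum n (T.D 0)) {i a b : ℕ} {H K : (T.St i).IdealSheafData} (hF : FactorAt T i a b H K) {η : T.St i}
    (hη : η ∈ brSet T i a H) : idealOrder K η < ((b : ℕ) : ℕ∞) := by
  by_contra hle
  rw [not_lt] at hle
  exact Set.disjoint_left.mp (brSet_disjoint_of_factorAt T g hB hD hF) hη ⟨hη.1, hη.2.1, hle⟩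

/-- **NO DOUBLE BIRTH (absolute step form)**: along the two factor chains of a factorization, the near-branches of `h_{j+1}` BORN at
step `j` are disjoint from ALL near-branches of the cofactor `K_{j+1}` (born or transported). [folklore] -/
theorem bornSet_disjoint_brSet_of_factorAt (T : ForcedTower) (g : T.St 0 ⟶ Spec (.of k)) (hB : IsBase (T.St 0) g)
    {n : ℕ} (hD : IsDatum n (T.D 0)) {m a b : ℕ} {H K : (T.St m).IdealSheafData} (hF : FactorAt T m a b H K) (j : ℕ) :
    Disjoint (bornSet T (m + j) a (facIter T m a H (j + 1))) (brSet T (m + (j + 1)) b (facIter T m b K (j + 1))) := by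
  have hF' := hF.forcing T g hB hD (j + 1)
  exact Set.disjoint_left.mpr fun η hη hK => Set.disjoint_left.mp (brSet_disjoint_of_factorAt T g hB hD hF') hη.1 hK

/-- **NO DOUBLE BIRTH (both born sets)**: at no step are near-branches of `h` and of `K` born at a common point — the sub-kind
«(DB) double birth» is EMPTY for every forced tower and every factorization. [folklore] -/
theorem bornSet_disjoint_bornSet_of_factorAt (T : ForcedTower) (g : T.St 0 ⟶ Spec (.of k)) (hB : IsBase (T.St 0) g)
    {n : ℕ} (hD : IsDatum n (T.D 0)) {m a b : ℕ} {H K : (T.St m).IdealSheafData} (hF : FactorAt T m a b H K) (j : ℕ) :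
    Disjoint (bornSet T (m + j) a (facIter T m a H (j + 1))) (bornSet T (m + j) b (facIter T m b K (j + 1))) :=
  (bornSet_disjoint_brSet_of_factorAt T g hB hD hF j).mono_right fun _ hη => hη.1

/-- **EVERY BIRTH IS PINNED**: at an exceptional near-branch of `h_{j+1}` born at step `j` the cofactor `K_{j+1}` has order `< b`
(so the weight-`b` locus of `K_{j+1}` meets the newborn branch in a proper closed — finite — subset). [folklore] -/
theorem idealOrder_lt_of_mem_bornSet (T : ForcedTower) (g : T.St 0 ⟶ Spec (.of k)) (hB : IsBase (T.St 0) g) {n : ℕ}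
    (hD : IsDatum n (T.D 0)) {m a b : ℕ} {H K : (T.St m).IdealSheafData} (hF : FactorAt T m a b H K) (j : ℕ)
    {η : T.St (m + (j + 1))} (hη : η ∈ bornSet T (m + j) a (facIter T m a H (j + 1))) :
    idealOrder (facIter T m b K (j + 1)) η < ((b : ℕ) : ℕ∞) :=
  idealOrder_lt_of_mem_brSet T g hB hD (hF.forcing T g hB hD (j + 1)) hη.1

end DisjointBranches

section CofactorLetters

/-! ## §125 (g39 · NEW · LETTERS + KERNEL LAW) THE COFACTOR LETTERS, THE MINIMAL-WEIGHT CURRENCY AND THE DESCENT LAW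

Letters BY MECHANISM, mirrors of g36's (I∞) and g38's (FB) ON THE COFACTOR of a principal companion: (KI∞) `IsolatedCofactorTower`
«the cofactor `K` (weight `b ≥ 1`) of some principal companion isolates the marked points in its OWN weight-`b` locus `Top(K_j, b)`
at every later stage», (KFB) `BirthFreeCofactorTower` «the cofactor chain has no exceptional birth», and the class-general
`IsolatedFactorTower` (any factor of weight `≥ 1` with cofactor of weight `≥ 1`, eventually isolated).  THE MINIMAL-WEIGHT CURRENCY
(the lens's own move — a minimal counterexample IN THE MARKING): `MinimalAt n := ∀ b, 1 ≤ b → b < n → ForcedTowersTerminate b`,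
with the ROOT EQUIVALENCE `(∀ n ≥ 1, ForcedTowersTerminate n) ↔ (∀ n ≥ 1, MinimalAt n → ForcedTowersTerminate n)` (strong induction).
THE DESCENT LAW (kernel, every `p` / field / class / weight / dimension ≤ 4, port-free): an eventually-isolated factor of weight
`1 ≤ b < n` ROOTS A FORCED TOWER OF THE CLASS AT WEIGHT `b` (g36's re-rooted restricted tower `companionTower`, which takes ANY ideal
sheaf — principality was only used for its `PrincipalRoot` letter), so `MinimalAt n` forbids it. -/

variable {k : Type} [Field k]

/-- **LETTER (KI∞) «ISOLATED COFACTOR» (g39 · structural, by mechanism; the mirror of (I∞) on the cofactor)**: some PRINCIPAL factor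
`h` of weight `a ≥ 2` at some stage `m` has a cofactor `K` of POSITIVE weight `b` whose weight-`b` locus `Top(K_j, b)` ISOLATES the
marked point at EVERY later stage. -/
def IsolatedCofactorTower (T : ForcedTower) : Prop :=
  ∃ (m a b : ℕ) (H K : (T.St m).IdealSheafData), FactorAt T m a b H K ∧ 2 ≤ a ∧ (stalkIdeal H (T.pt m)).IsPrincipal ∧ 1 ≤ b ∧
    ∀ j, IsIsolatedIn (companionMarked T m b K j).support (T.pt (m + j))

/-- pure logic: the NEGATION of (KI∞) — «COFACTOR RECURRENTLY NON-ISOLATED»: the cofactor of every principal companion of weight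
`≥ 2` with positive coweight has a NON-ISOLATED stage. [folklore] -/
theorem not_isolatedCofactorTower_iff (T : ForcedTower) :
    ¬ IsolatedCofactorTower T ↔
      ∀ (m a b : ℕ) (H K : (T.St m).IdealSheafData), FactorAt T m a b H K → 2 ≤ a → (stalkIdeal H (T.pt m)).IsPrincipal →
        1 ≤ b → ∃ j, ¬ IsIsolatedIn (companionMarked T m b K j).support (T.pt (m + j)) := by
  simp only [IsolatedCofactorTower, not_exists, not_and, not_forall]

/-- **LETTER (KFB) «BIRTH-FREE COFACTOR» (g39 · structural, by mechanism; the mirror of (FB) on the cofactor)**: the cofactor chain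
`K_j = facIter T m b K j` of some principal companion of weight `a ≥ 2` (coweight `b ≥ 1`) has NO exceptional near-branch born
at any later step. -/
def BirthFreeCofactorTower (T : ForcedTower) : Prop :=
  ∃ (m a b : ℕ) (H K : (T.St m).IdealSheafData), FactorAt T m a b H K ∧ 2 ≤ a ∧ (stalkIdeal H (T.pt m)).IsPrincipal ∧ 1 ≤ b ∧
    ∀ j, ¬ BornAt T m b K j

/-- pure logic: the NEGATION of (KFB) — «COFACTOR BIRTH-RECURRENT». [folklore] -/
theorem not_birthFreeCofactorTower_iff (T : ForcedTower) :
    ¬ BirthFreeCofactorTower T ↔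
      ∀ (m a b : ℕ) (H K : (T.St m).IdealSheafData), FactorAt T m a b H K → 2 ≤ a → (stalkIdeal H (T.pt m)).IsPrincipal →
        1 ≤ b → ∃ j, BornAt T m b K j := by
  simp only [BirthFreeCofactorTower, not_exists, not_and, not_forall, not_not]

/-- **LETTER «ISOLATED FACTOR» (g39 · class-general)**: SOME factor `K` of positive weight `b`, with cofactor of positive weight, of the
marked stalk at some stage isolates the marked point in its own weight-`b` locus at every later stage (no principality anywhere). -/
def IsolatedFactorTower (T : ForcedTower) : Prop :=
  ∃ (m a b : ℕ) (H K : (T.St m).IdealSheafData), FactorAt T m a b H K ∧ 1 ≤ a ∧ 1 ≤ b ∧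
    ∀ j, IsIsolatedIn (companionMarked T m b K j).support (T.pt (m + j))

/-- (KI∞) ⟹ «isolated factor». [folklore] -/
theorem isolatedFactorTower_of_isolatedCofactorTower {T : ForcedTower} (h : IsolatedCofactorTower T) :
    IsolatedFactorTower T := by
  obtain ⟨m, a, b, H, K, hF, ha, -, hb, hI⟩ := h
  exact ⟨m, a, b, H, K, hF, by omega, hb, hI⟩

/-- (KI∞) ⟹ (KFB) (pure topology, as (I∞) ⟹ (FB)): an isolated cofactor has no near-branches at all from its stage on, hence no
births. [folklore] -/
theorem birthFreeCofactor_of_isolatedCofactorTower (T : ForcedTower) (h : IsolatedCofactorTower T) :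
    BirthFreeCofactorTower T := by
  obtain ⟨m, a, b, H, K, hF, ha, hP, hb, hiso⟩ := h
  refine ⟨m, a, b, H, K, hF, ha, hP, hb, fun j hborn => ?_⟩
  obtain ⟨η, hη, -⟩ := hborn
  obtain ⟨-, U, hxU, hU⟩ := hiso (j + 1)
  have hηU : η ∈ (U : Set (T.St (m + (j + 1)))) := hη.1.mem_open U.isOpen hxU
  have hηS : η ∈ ((companionMarked T m b K (j + 1)).support : Set (T.St (m + (j + 1)))) :=
    (mem_support_companionMarked_iff T m b K (j + 1) η).mpr hη.2.2
  exact hη.2.1 (hU ⟨hηU, hηS⟩)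

/-- **THE MINIMAL-WEIGHT CURRENCY**: `MinimalAt n` — «no infinite forced tower of the class exists at any positive weight `< n`»
(the induction hypothesis of a minimal counterexample in the marking).  THIS IS THE TREE'S g16 «WeightDescent» CURRENCY, CITED, NOT
NEW: it is VERBATIM the binder `hlow : ∀ n', 1 ≤ n' → n' < n → ForcedTowersTerminate n'` of `ftt_step_of_g16` /
`forcedTowersTerminate_of_g16` (`Nat.strong_induction_on` on the weight; Theorems/MaxContactCutWeightDescent,
WeightDescentKernels `factorIsolated_of_descent (hDesc : DescentPort n) (hlow)`) and of every later root step `ftt_step_of_g17 … g22`;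
named here only so that cells can be stated «in minimal currency». -/
def MinimalAt (n : ℕ) : Prop :=
  ∀ b : ℕ, 1 ≤ b → b < n → ForcedTowersTerminate b

/-- `MinimalAt 1` holds vacuously. [folklore] -/
theorem minimalAt_one : MinimalAt 1 := fun b hb hb1 => absurd hb1 (by omega)

/-- `MinimalAt` is antitone in the weight. [folklore] -/
theorem MinimalAt.anti {m n : ℕ} (hmn : m ≤ n) (h : MinimalAt n) : MinimalAt m :=
  fun b hb hbm => h b hb (lt_of_lt_of_le hbm hmn)

/-- **THE ROOT EQUIVALENCE (pure logic, strong induction)**: «no forced tower at any positive weight» is EQUIVALENT to its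
minimal-counterexample form «no forced tower at any positive weight that is MINIMAL» — deciding a cell under `MinimalAt n`
contributes to `∀ n ≥ 1, ForcedTowersTerminate n` exactly what an absolute decision does. [folklore] -/
theorem forall_forcedTowersTerminate_iff_minimal :
    (∀ n, 1 ≤ n → ForcedTowersTerminate n) ↔ ∀ n, 1 ≤ n → MinimalAt n → ForcedTowersTerminate n := by
  refine ⟨fun h n hn _ => h n hn, fun h n => ?_⟩
  induction n using Nat.strong_induction_on with
  | _ n ih => exact fun hn => h n hn fun b hb hbn => ih b hbn hb

/-- **THE DESCENT LAW (KERNEL; every `p`, every field, EVERY class `P`, every weight, dimension ≤ 4; port-free)**: an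
EVENTUALLY-ISOLATED FACTOR of weight `1 ≤ b < n` roots a FORCED TOWER OF THE CLASS AT WEIGHT `b` — the restricted re-rooted factor tower
`companionTower T m b K hI g hB h0` of g36 (root `U₀ = {ord K ≤ b} ∋ x_m`, `IsBase`, `IsDatum b`, empty boundary BY NAME) — so a
tower minimal in the marking has NO eventually-isolated factor. (Sources: Kollar2007, 3.58–3.60; BierstoneGrigorievMilmanWlodarczyk2011,
§3.1–3.2; CossartJannsenSaito2020, §4 p.58.) -/
theorem noTower_isolatedFactor_of_minimal (n : ℕ) (P : ForcedTower → Prop) (hmin : MinimalAt n) :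
    NoTower n fun T => P T ∧ IsolatedFactorTower T := by
  intro p hp K _ _ T g hB hD hE hT
  obtain ⟨-, m, a, b, H, K', hF, ha, hb, hI⟩ := hT
  have hab : a + b = n := hF.add_eq T g hB hD
  have h0 : (towerOfCompanion T m b K' hI).pt 0 ∈ companionRootOpens T m b K' hI g hB :=
    pt_mem_companionRootOpens T m b K' hI g hB hF.symm
  exact hmin b hb (by omega) p hp K (companionTower T m b K' hI g hB h0)
    ((companionRootOpens T m b K' hI g hB).ι ≫ toRoot T m ≫ g) (companionTower_isBase T m b K' hI g hB h0)
    (companionTower_isDatum T m b K' hI g hB h0) (companionTower_boundary T m b K' hI g hB h0)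

/-- the descent law on the wild column. [folklore] -/
theorem noTowerWild_isolatedFactor_of_minimal (n : ℕ) (P : ForcedTower → Prop) (hmin : MinimalAt n) :
    NoTowerWild n fun T => P T ∧ IsolatedFactorTower T :=
  fun p hp _ K _ _ T g hB hD hE hT => noTower_isolatedFactor_of_minimal n P hmin p hp K T g hB hD hE hT

/-- **THE DESCENT LAW FOR (KI∞)**: in minimal currency NO forced tower of any class has an isolated cofactor. [folklore] -/
theorem noTower_isolatedCofactor_of_minimal (n : ℕ) (P : ForcedTower → Prop) (hmin : MinimalAt n) :
    NoTower n fun T => P T ∧ IsolatedCofactorTower T :=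
  fun p hp K _ _ T g hB hD hE hT => noTower_isolatedFactor_of_minimal n P hmin p hp K T g hB hD hE
    ⟨hT.1, isolatedFactorTower_of_isolatedCofactorTower hT.2⟩

/-- the (KI∞) descent law on the wild column. [folklore] -/
theorem noTowerWild_isolatedCofactor_of_minimal (n : ℕ) (P : ForcedTower → Prop) (hmin : MinimalAt n) :
    NoTowerWild n fun T => P T ∧ IsolatedCofactorTower T :=
  fun p hp _ K _ _ T g hB hD hE hT => noTower_isolatedCofactor_of_minimal n P hmin p hp K T g hB hD hE hT

/-- **REMARK (0-weight): IN MINIMAL CURRENCY g36's COMPANION KILL NEEDS NO SURFACE PORT** — an isolated principal companion with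
cofactor of positive weight is an isolated factor. [folklore] -/
theorem noTower_isolatedCompanion_posCoweight_of_minimal (n : ℕ) (P : ForcedTower → Prop) (hmin : MinimalAt n) :
    NoTower n fun T => P T ∧ ∃ (m a b : ℕ) (H K : (T.St m).IdealSheafData), FactorAt T m a b H K ∧ 2 ≤ a ∧ 1 ≤ b ∧
      ∀ j, IsIsolatedIn (companionMarked T m a H j).support (T.pt (m + j)) := by
  intro p hp K _ _ T g hB hD hE hT
  obtain ⟨hP, m, a, b, H, K', hF, ha, hb, hI⟩ := hT
  exact noTower_isolatedFactor_of_minimal n P hmin p hp K T g hB hD hE ⟨hP, m, b, a, K', H, hF.symm, hb, by omega, hI⟩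

end CofactorLetters

end Summit.ResolutionOfSingularities.ResolutionOfSingularities.Theorems.HugValuationCut
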